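import Literature.IUT.LogVolume.TensorPacketOrbitSpan
import Literature.IUT.LogVolume.TensorPacketHull
import Literature.IUT.LogVolume.LogUnitsSubmodule
import HarnessLib

/-!
# Orbit-STABLE sub-indeterminacies of a tensor packet give ZERO hull gain: `hull(⋃_{g∈H} g·(c·(R_I)^∼)) = c·(R_I)^∼`
# (Dupuy–Hilado §4.9/§4.12; [IUTchII] Ex. 1.8 (iv) "another example … the image `Im(Ẑ^×)`"; [IUTchIV] Prop. 1.2)

Proof-only file of the abc-iut cell (WAVE-3 discharge seat abc-iut-c312-d1, gen 10; row «C:PERIMAGE-IND2-SEMILINEAR», C LEAD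
ruling C-R93 (a); the quantitative kernel form of referee finding **F-B28-1** (ref-b pass B28, `ref/REFEREE-PASS-B28.md` §2:
"typed `indTwo` = the Dupuy–Hilado CONTAINER `Aut_{ℚ_p}(V : log_p(R_I^×))`; print's (Ind2) = factorwise independent copies of
`Ism`; the container reading is ANTI-conservative for per-image readings")). TAKES NO SIDE on [IUTchIII] Cor. 3.12.

THE LANDED TWO-SIDED FACT (abc-iut-w5-d180 / s2-p2, `TensorPacketOrbitSpan.packetHull_orbit_eq_zpow`,
`GenuineLogThetaPerImageExactVolume`): over the FULL container `indTwo p k`, the hull of the orbit of a region `M` of content exactly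
`p^m` is `hull(p^m·log_p(R_I^×))` — for the per-image Θ-region `M_P = ι_j(t)·(R_I)^∼` this is the whole different-plus-shell gain
that makes the cell's typed per-image [IUTchIII] Cor. 3.12 (reading (P)) hold at the tabulated Szpiro-bad data. THIS FILE records
the opposite end, for ANY family of automorphisms of the same packet that STABILISES the region:

* `packetHull_union_iUnion_image_eq_of_forall_subset`, `packetHull_iUnion_image_eq_of_forall_subset` — if `hull(M) = M` and every
  `φ_g` (`g ∈ G`) maps `M` into itself (and some `φ_{g₀}` maps it ONTO itself, e.g. `φ_{g₀} = id`), then `hull(⋃_g φ_g(M)) = M`;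
  `packetHull_iUnion_coe_image_eq_of_le_stabilizer` — the same for a subgroup `H` of `V ≃ₗ[ℚ_p] V` inside the stabiliser of `M`;
* WHICH automorphisms stabilise a translate `c·(R_I)^∼` (the shape of every per-image Θ-region, `c = ι_j(t)`):
  `image_smul_normalizedPacket_eq_of_forall_eq_mul` — multiplication by a UNIT of `(R_I)^∼`; `image_smul_normalizedPacket_eq_of_algEquiv`
  — any `ℚ_p`-ALGEBRA automorphism of `V` preserving `(R_I)^∼` and fixing `c`; in particular (`smul_logPacket_subset_of_norm_le`,
  `smulOfUnit_mem_indTwo`, `image_smulOfUnit_smul_normalizedPacket`) the SCALARS `u ∈ ℤ_p^×` — the image `Im(Ẑ^×) → ℤ_p^×` that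
  [IUTchII] Ex. 1.8 (iv) (kurims p. 39 l. 19–25) names as "another example" of a `Γ^{×μ} ⊆ Ism` — lie IN the container AND stabilise
  every translate;
* `packetHull_iUnion_smulOfUnit_eq`, `packetLogμ_packetHull_iUnion_smulOfUnit_eq` — hence over the `ℤ_p^×`-scalar sub-indeterminacy
  (any subgroup of it) the hull of the orbit of `c·(R_I)^∼` IS `c·(R_I)^∼` and its `log μ̄` is the BARE value `log μ̄(c·(R_I)^∼)`:
  ZERO gain, against the container's `−m·log p + log μ̄(hull(log_p(R_I^×)))`.

HONEST WORDS (C-R93 (a)): «zero per-image gain» is a statement about OUR hull functional (`packetHull`, the `(R_I)^∼`-span) on OUR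
container; which sub-indeterminacies print's (Ind2) intends — factorwise `Ism` ([IUTchII] Ex. 1.8 (iv); [IUTchIII] Thm. 3.11 (i),
Rem. 3.9.x) — and whether they stabilise the Θ-regions is READING MATTER for the referees; nothing here decides print's (P), and no
side is taken. [cite: DupuyHilado2025, §4.9, §4.12] [cite: Mochizuki2012, IUTchII Ex. 1.8 (iv) p. 39; IUTchIV Prop. 1.1–1.2 p. 9–10;
IUTchIII Cor. 3.12 proof Step (x) p. 181] [cite: WeilBNT1967, Ch. II §2, Th. 2] [claim: Mochizuki2012, status: disputed] for every
IUT quotation. PROOF-ONLY: no definitions, no new `Prop`.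
-/

noncomputable section

open Set
open scoped Pointwise TensorProduct

namespace Literature.IUT.LogVolume

variable (p : ℕ) [Fact p.Prime]
variable {I : Type} [Fintype I] [DecidableEq I]
variable (k : I → Type) [∀ i, NontriviallyNormedField (k i)] [∀ i, NormedAlgebra ℚ_[p] (k i)]

/-! ## 1. Orbit-stable families: the hull of the orbit is the region itself -/

omit [Fintype I] [DecidableEq I] in
/-- **Stable family ⟹ no hull gain** (with the region itself in the union): if `hull(M) = M` and every `φ_g` maps `M` into `M`,
then `hull(M ∪ ⋃_g φ_g(M)) = M`. [cite: DupuyHilado2025, §4.12] -/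
theorem packetHull_union_iUnion_image_eq_of_forall_subset {M : Set (PacketAlgebra p k)}
    (hM : packetHull p k M = M) {G : Type*} (φ : G → (PacketAlgebra p k ≃ₗ[ℚ_[p]] PacketAlgebra p k))
    (hφ : ∀ g, φ g '' M ⊆ M) :
    packetHull p k (M ∪ ⋃ g, φ g '' M) = M := by
  have hU : M ∪ ⋃ g, φ g '' M = M :=
    Set.union_eq_self_of_subset_right (Set.iUnion_subset hφ)
  rw [hU, hM]

omit [Fintype I] [DecidableEq I] in
/-- **Stable family ⟹ no hull gain**: if `hull(M) = M`, every `φ_g` maps `M` into `M` and one `φ_{g₀}` maps it onto `M` (e.g. the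
identity), then `hull(⋃_g φ_g(M)) = M`. [cite: DupuyHilado2025, §4.12] -/
theorem packetHull_iUnion_image_eq_of_forall_subset {M : Set (PacketAlgebra p k)}
    (hM : packetHull p k M = M) {G : Type*} (φ : G → (PacketAlgebra p k ≃ₗ[ℚ_[p]] PacketAlgebra p k))
    (hφ : ∀ g, φ g '' M ⊆ M) {g₀ : G} (h₀ : φ g₀ '' M = M) :
    packetHull p k (⋃ g, φ g '' M) = M := by
  have hU : ⋃ g, φ g '' M = M :=
    Set.Subset.antisymm (Set.iUnion_subset hφ) (h₀.symm.subset.trans (Set.subset_iUnion (fun g => φ g '' M) g₀))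
  rw [hU, hM]

omit [Fintype I] [DecidableEq I] in
/-- **A subgroup inside the stabiliser gives no hull gain**: for a subgroup `H` of `Aut_{ℚ_p}(V)` each of whose elements maps `M`
into itself, and `hull(M) = M`: `hull(⋃_{g∈H} g(M)) = M` (the identity is in `H`). [cite: DupuyHilado2025, §4.9, §4.12] -/
theorem packetHull_iUnion_coe_image_eq_of_forall_subset {M : Set (PacketAlgebra p k)}
    (hM : packetHull p k M = M) (H : Subgroup (PacketAlgebra p k ≃ₗ[ℚ_[p]] PacketAlgebra p k))
    (hH : ∀ g ∈ H, (g : PacketAlgebra p k ≃ₗ[ℚ_[p]] PacketAlgebra p k) '' M ⊆ M) :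
    packetHull p k (⋃ g : H, (g : PacketAlgebra p k ≃ₗ[ℚ_[p]] PacketAlgebra p k) '' M) = M := by
  refine packetHull_iUnion_image_eq_of_forall_subset p k hM
    (fun g : H => (g : PacketAlgebra p k ≃ₗ[ℚ_[p]] PacketAlgebra p k)) (fun g => hH g g.2) (g₀ := (1 : H)) ?_
  have h1 : (((1 : H) : PacketAlgebra p k ≃ₗ[ℚ_[p]] PacketAlgebra p k) : PacketAlgebra p k → PacketAlgebra p k) = id := by
    rw [OneMemClass.coe_one, LinearEquiv.coe_one]
  simp only [h1, Set.image_id]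

omit [Fintype I] [DecidableEq I] in
/-- The stabiliser form: `H ≤ Stab(M)` for the pointwise action of `Aut_{ℚ_p}(V)` on subsets of `V` (`g • M = g(M)`), `hull(M) = M`
⟹ `hull(⋃_{g∈H} g(M)) = M`. [cite: DupuyHilado2025, §4.9, §4.12] -/
theorem packetHull_iUnion_coe_image_eq_of_le_stabilizer {M : Set (PacketAlgebra p k)}
    (hM : packetHull p k M = M) (H : Subgroup (PacketAlgebra p k ≃ₗ[ℚ_[p]] PacketAlgebra p k))
    (hH : H ≤ MulAction.stabilizer (PacketAlgebra p k ≃ₗ[ℚ_[p]] PacketAlgebra p k) M) :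
    packetHull p k (⋃ g : H, (g : PacketAlgebra p k ≃ₗ[ℚ_[p]] PacketAlgebra p k) '' M) = M := by
  refine packetHull_iUnion_coe_image_eq_of_forall_subset p k hM H fun g hg => ?_
  have h := MulAction.mem_stabilizer_iff.mp (hH hg)
  rw [← Set.image_smul] at h
  exact h.le

/-! ## 2. Which automorphisms stabilise a translate `c·(R_I)^∼` -/

omit [Fintype I] [DecidableEq I] in
/-- Translates of the integral structure are hull-closed (abc-iut-S2, restated for the chain). [cite: Mochizuki2012, IUTchIII Rmk. 3.9.5 (i) p. 127] -/
theorem packetHull_translate (c : PacketAlgebra p k) :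
    packetHull p k (c • (normalizedPacket p k : Set (PacketAlgebra p k))) =
      c • (normalizedPacket p k : Set (PacketAlgebra p k)) :=
  packetHull_smul_normalizedPacket p k c

omit [Fintype I] [DecidableEq I] in
/-- **Multiplication by a unit of `(R_I)^∼` stabilises every translate**: if `φ(x) = r·x` with `r, s ∈ (R_I)^∼`, `r·s = 1`, then
`φ(c·(R_I)^∼) = c·(R_I)^∼` (`V` is commutative; `r·(R_I)^∼ = (R_I)^∼`). [cite: Mochizuki2012, IUTchIV Prop. 1.1 p. 9] -/
theorem image_smul_normalizedPacket_eq_of_forall_eq_mul {φ : PacketAlgebra p k ≃ₗ[ℚ_[p]] PacketAlgebra p k}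
    {r s : PacketAlgebra p k} (hr : r ∈ normalizedPacket p k) (hs : s ∈ normalizedPacket p k) (hrs : r * s = 1)
    (hφ : ∀ x, φ x = r * x) (c : PacketAlgebra p k) :
    φ '' (c • (normalizedPacket p k : Set (PacketAlgebra p k))) = c • (normalizedPacket p k : Set (PacketAlgebra p k)) := by
  ext y
  simp only [Set.mem_image, Set.mem_smul_set, smul_eq_mul]
  constructor
  · rintro ⟨x, ⟨z, hz, rfl⟩, rfl⟩
    refine ⟨r * z, (normalizedPacket p k).mul_mem hr hz, ?_⟩
    rw [hφ]
    ring
  · rintro ⟨z, hz, rfl⟩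
    refine ⟨c * (s * z), ⟨s * z, (normalizedPacket p k).mul_mem hs hz, rfl⟩, ?_⟩
    rw [hφ]
    calc r * (c * (s * z)) = (r * s) * (c * z) := by ring
      _ = c * z := by rw [hrs, one_mul]

omit [Fintype I] [DecidableEq I] in
/-- **Algebra automorphisms preserving `(R_I)^∼` and fixing `c` stabilise `c·(R_I)^∼`** (e.g. automorphisms induced by field
automorphisms of the tensor factors other than the slot carrying `c = ι_j(t)`). [cite: Mochizuki2012, IUTchIV Prop. 1.1 p. 9] -/
theorem image_smul_normalizedPacket_eq_of_algEquiv (τ : PacketAlgebra p k ≃ₐ[ℚ_[p]] PacketAlgebra p k)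
    (hτ : ∀ x, τ x ∈ normalizedPacket p k ↔ x ∈ normalizedPacket p k) {c : PacketAlgebra p k} (hc : τ c = c) :
    τ.toLinearEquiv '' (c • (normalizedPacket p k : Set (PacketAlgebra p k))) =
      c • (normalizedPacket p k : Set (PacketAlgebra p k)) := by
  ext y
  simp only [AlgEquiv.toLinearEquiv_apply, Set.mem_image, Set.mem_smul_set, smul_eq_mul]
  constructor
  · rintro ⟨x, ⟨z, hz, rfl⟩, rfl⟩
    refine ⟨τ z, (hτ z).mpr hz, ?_⟩
    rw [map_mul, hc]
  · rintro ⟨z, hz, rfl⟩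
    refine ⟨c * τ.symm z, ⟨τ.symm z, ?_, rfl⟩, ?_⟩
    · have h := (hτ (τ.symm z)).mp
      rw [AlgEquiv.apply_symm_apply] at h
      exact h hz
    · rw [map_mul, hc, AlgEquiv.apply_symm_apply]

/-! ### The scalars `u ∈ ℤ_p^×` — [IUTchII] Ex. 1.8 (iv)'s `Im(Ẑ^×)` — lie in the container and stabilise every translate -/

section Scalars

variable [Nonempty I]

omit [Fintype I] [DecidableEq I] in
/-- `ℤ_p`-scalars preserve `log_p(R_I^×)`: for `‖u‖ ≤ 1`, `u·log_p(R_I^×) ⊆ log_p(R_I^×)` (scale one tensor factor; each `log_p(R_i^×)` is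
a `ℤ_p`-module, `smul_mem_logUnits`). [cite: Mochizuki2012, IUTchIV Prop. 1.2 p. 10] -/
theorem smul_logPacket_subset_of_norm_le [∀ i, IsUltrametricDist (k i)] [∀ i, ProperSpace (k i)]
    {u : ℚ_[p]} (hu : ‖u‖ ≤ 1) :
    u • (logPacket p k : Set (PacketAlgebra p k)) ⊆ logPacket p k := by
  classical
  obtain ⟨i₀⟩ := ‹Nonempty I›
  -- `u` as an element of `ℤ_p`, acting through `ℚ_p`
  obtain ⟨c, hc⟩ : ∃ c : ℤ_[p], (c : ℚ_[p]) = u := ⟨⟨u, hu⟩, rfl⟩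
  have hcu : ∀ z : k i₀, c • z = u • z := fun z => by
    rw [← hc]; exact (algebraMap_smul (R := ℤ_[p]) ℚ_[p] c z).symm
  rintro y ⟨x, hx, rfl⟩
  change x ∈ logPacket p k at hx
  show u • x ∈ logPacket p k
  induction hx using AddSubgroup.closure_induction with
  | mem t ht =>
    obtain ⟨z, hz, rfl⟩ := ht
    -- scale the factor `i₀`
    have hu' : u • z i₀ ∈ logUnits (k i₀) := by
      rw [← hcu]; exact smul_mem_logUnits p (k i₀) c (hz i₀)
    have hzu : ∀ i, Function.update z i₀ (u • z i₀) i ∈ logUnits (k i) := by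
      intro i
      by_cases h : i = i₀
      · subst h; rw [Function.update_self]; exact hu'
      · rw [Function.update_of_ne h]; exact hz i
    have heq : u • purePacket p k z = purePacket p k (Function.update z i₀ (u • z i₀)) := by
      unfold purePacket
      rw [MultilinearMap.map_update_smul, Function.update_eq_self]
    rw [heq]
    exact AddSubgroup.subset_closure ⟨_, hzu, rfl⟩
  | zero => rw [smul_zero]; exact zero_mem _
  | add a b _ _ ha hb => rw [smul_add]; exact add_mem ha hb
  | neg a _ ha => rw [smul_neg]; exact neg_mem ha

omit [Fintype I] [DecidableEq I] in
/-- **The unit scalars are in the container**: for `‖u‖ = 1`, the homothety `x ↦ u·x` lies in `indTwo p k = Aut_{ℚ_p}(V : log_p(R_I^×))`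
(`u` and `u⁻¹` both preserve the lattice). This is the image `Im(Ẑ^×) ↠ ℤ_p^× ↪ Ism` of [IUTchII] Ex. 1.8 (iv), read on the log-shell.
[cite: Mochizuki2012, IUTchII Ex. 1.8 (iv) p. 39] [cite: DupuyHilado2025, §4.9] -/
theorem smulOfUnit_mem_indTwo [∀ i, IsUltrametricDist (k i)] [∀ i, ProperSpace (k i)]
    {u : ℚ_[p]} (hu : ‖u‖ = 1) :
    LinearEquiv.smulOfUnit (Units.mk0 u (norm_ne_zero_iff.mp (by rw [hu]; exact one_ne_zero))) ∈ indTwo p k := by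
  have hu0 : u ≠ 0 := norm_ne_zero_iff.mp (by rw [hu]; exact one_ne_zero)
  refine mem_indTwo_of_image_eq p k (Set.Subset.antisymm ?_ ?_)
  · rintro y ⟨x, hx, rfl⟩
    exact smul_logPacket_subset_of_norm_le p k hu.le ⟨x, hx, rfl⟩
  · intro x hx
    refine ⟨u⁻¹ • x, smul_logPacket_subset_of_norm_le p k (by rw [norm_inv, hu, inv_one]) ⟨x, hx, rfl⟩, ?_⟩
    show (Units.mk0 u hu0 : ℚ_[p]) • (u⁻¹ • x) = x
    rw [Units.val_mk0, smul_smul, mul_inv_cancel₀ hu0, one_smul]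

omit [Fintype I] in
/-- **The unit scalars stabilise every translate**: `u·(c·(R_I)^∼) = c·(R_I)^∼` for `‖u‖ = 1` (`u, u⁻¹ ∈ ℤ_p ⊆ (R_I)^∼`).
[cite: Mochizuki2012, IUTchIV Prop. 1.1 p. 9] -/
theorem image_smulOfUnit_smul_normalizedPacket {u : ℚ_[p]} (hu : ‖u‖ = 1) (c : PacketAlgebra p k) :
    (LinearEquiv.smulOfUnit (Units.mk0 u (norm_ne_zero_iff.mp (by rw [hu]; exact one_ne_zero))) :
        PacketAlgebra p k ≃ₗ[ℚ_[p]] PacketAlgebra p k) '' (c • (normalizedPacket p k : Set (PacketAlgebra p k))) =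
      c • (normalizedPacket p k : Set (PacketAlgebra p k)) := by
  have hu0 : u ≠ 0 := norm_ne_zero_iff.mp (by rw [hu]; exact one_ne_zero)
  have hR : integerPacket p k ≤ normalizedPacket p k := integerPacket_le_normalizedPacket p k
  refine image_smul_normalizedPacket_eq_of_forall_eq_mul p k
    (r := algebraMap ℚ_[p] (PacketAlgebra p k) u) (s := algebraMap ℚ_[p] (PacketAlgebra p k) u⁻¹)
    (hR (algebraMap_mem_integerPacket p k hu.le))
    (hR (algebraMap_mem_integerPacket p k (by rw [norm_inv, hu, inv_one]))) ?_ (fun x => ?_) c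
  · rw [← map_mul, mul_inv_cancel₀ hu0, map_one]
  · show (Units.mk0 u hu0 : ℚ_[p]) • x = _
    rw [Units.val_mk0, Algebra.smul_def]

omit [Fintype I] in
/-- **ZERO HULL GAIN OVER THE `ℤ_p^×`-SCALAR SUB-INDETERMINACY**: for any subgroup `H` of the container all of whose elements are unit
homotheties, `hull(⋃_{g∈H} g(c·(R_I)^∼)) = c·(R_I)^∼` — against the FULL container's `hull(p^m·log_p(R_I^×))`
(`packetHull_orbit_eq_zpow`). [cite: DupuyHilado2025, §4.9, §4.12] [cite: Mochizuki2012, IUTchII Ex. 1.8 (iv) p. 39] -/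
theorem packetHull_iUnion_image_eq_of_forall_eq_smul (H : Subgroup (PacketAlgebra p k ≃ₗ[ℚ_[p]] PacketAlgebra p k))
    (hH : ∀ g ∈ H, ∃ u : ℚ_[p], ‖u‖ = 1 ∧ ∀ x, (g : PacketAlgebra p k ≃ₗ[ℚ_[p]] PacketAlgebra p k) x = u • x)
    (c : PacketAlgebra p k) :
    packetHull p k (⋃ g : H, (g : PacketAlgebra p k ≃ₗ[ℚ_[p]] PacketAlgebra p k) ''
        (c • (normalizedPacket p k : Set (PacketAlgebra p k)))) =
      c • (normalizedPacket p k : Set (PacketAlgebra p k)) := by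
  have hR : integerPacket p k ≤ normalizedPacket p k := integerPacket_le_normalizedPacket p k
  refine packetHull_iUnion_coe_image_eq_of_forall_subset p k (packetHull_translate p k c) H fun g hg => ?_
  obtain ⟨u, hu, hgu⟩ := hH g hg
  have hu0 : u ≠ 0 := norm_ne_zero_iff.mp (by rw [hu]; exact one_ne_zero)
  refine (image_smul_normalizedPacket_eq_of_forall_eq_mul p k
    (r := algebraMap ℚ_[p] (PacketAlgebra p k) u) (s := algebraMap ℚ_[p] (PacketAlgebra p k) u⁻¹)
    (hR (algebraMap_mem_integerPacket p k hu.le))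
    (hR (algebraMap_mem_integerPacket p k (by rw [norm_inv, hu, inv_one]))) ?_ (fun x => ?_) c).le
  · rw [← map_mul, mul_inv_cancel₀ hu0, map_one]
  · rw [hgu, Algebra.smul_def]

end Scalars

/-! ## 3. The log-volume: zero gain -/

omit [DecidableEq I] in
/-- **No gain in `log μ̄`**: for a stable family as in §1, the log-measure of the hull of the orbit is the log-measure of the region.
[cite: DupuyHilado2025, §4.12] -/
theorem packetLogμ_packetHull_iUnion_coe_image_eq [∀ i, IsUltrametricDist (k i)] [∀ i, ProperSpace (k i)]
    {M : Set (PacketAlgebra p k)} (hM : packetHull p k M = M)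
    (H : Subgroup (PacketAlgebra p k ≃ₗ[ℚ_[p]] PacketAlgebra p k))
    (hH : ∀ g ∈ H, (g : PacketAlgebra p k ≃ₗ[ℚ_[p]] PacketAlgebra p k) '' M ⊆ M) :
    packetLogμ p k (packetHull p k (⋃ g : H, (g : PacketAlgebra p k ≃ₗ[ℚ_[p]] PacketAlgebra p k) '' M)) =
      packetLogμ p k M := by
  rw [packetHull_iUnion_coe_image_eq_of_forall_subset p k hM H hH]

/-- **ZERO GAIN IN `log μ̄` OVER THE UNIT SCALARS**: `log μ̄(hull(⋃_{g∈H} g(c·(R_I)^∼))) = log μ̄(c·(R_I)^∼)` for every subgroup `H` of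
unit homotheties — the BARE value, whereas over the full container the hull has `log μ̄ = −m·log p + log μ̄(hull(log_p(R_I^×)))`
(`GenuineLogThetaPerImageExactVolume`). [cite: DupuyHilado2025, §4.9, §4.12] [cite: Mochizuki2012, IUTchII Ex. 1.8 (iv) p. 39] -/
theorem packetLogμ_packetHull_iUnion_image_eq_of_forall_eq_smul [Nonempty I] [∀ i, IsUltrametricDist (k i)]
    [∀ i, ProperSpace (k i)] (H : Subgroup (PacketAlgebra p k ≃ₗ[ℚ_[p]] PacketAlgebra p k))
    (hH : ∀ g ∈ H, ∃ u : ℚ_[p], ‖u‖ = 1 ∧ ∀ x, (g : PacketAlgebra p k ≃ₗ[ℚ_[p]] PacketAlgebra p k) x = u • x)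
    (c : PacketAlgebra p k) :
    packetLogμ p k (packetHull p k (⋃ g : H, (g : PacketAlgebra p k ≃ₗ[ℚ_[p]] PacketAlgebra p k) ''
        (c • (normalizedPacket p k : Set (PacketAlgebra p k))))) =
      packetLogμ p k (c • (normalizedPacket p k : Set (PacketAlgebra p k))) := by
  rw [packetHull_iUnion_image_eq_of_forall_eq_smul p k H hH c]

end Literature.IUT.LogVolume

end
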